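import Literature.NumberTheory.Irrationality.KrattenthalerZudilin2019.ZetaOddMinusPiPowers
import Literature.NumberTheory.Irrationality.CressonFischlerRivoal2008.WellPoisedSymmetry
import Literature.NumberTheory.Transcendental.BallRivoalLinearForms
import HarnessLib

/-!
# Krattenthaler–Zudilin 2019, §4: `r_n ∈ ℚπ⁴ + ℚπ²` and `r_1 = 19π⁴/6 − 125π²/4` — the named facts `rFour_mem_span`, `rFour_one` PROVED

Topic `Literature/NumberTheory/Irrationality/KrattenthalerZudilin2019` (objects of `ZetaOddMinusPiPowers.lean`:
`RFour n t = 2^{8n} n!⁴ (2n)!² ∏_{j<4n}(t−n+j) / ((4n)! ∏_{j≤2n}(t−½+j)⁴)`, `rFour n = Σ_{t≥1} R_n(t)`, the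
named facts `rFour_mem_span : ∀ n, ∃ a b : ℚ, r_n = aπ⁴ − bπ²`, `rFour_one : r_1 = 19π⁴/6 − 125π²/4`, and **Lemma 1**
PROVED there, `Lemma1.lemma1`).
Source: C. Krattenthaler, W. Zudilin, *Hypergeometry inspired by irrationality questions*, Kyushu J. Math.
**73** (2019) 189–203 [KrattenthalerZudilin2019], §4, READ ON THE PAGE (arXiv:1802.08856, held text
`paper:arxiv-1802.08856` p0007): "It is standard to sum the rational function `R_n(t)` … by expanding it into
the sum of partial fractions; the well-poised symmetry … (and the residue sum theorem) imply then that
`r_n ∈ ℚπ⁴ + ℚπ² + ℚ` for `n = 0, 1, 2, …`. … `r_n = a_nπ⁴ − b_nπ² ∈ ℚπ⁴ + ℚπ²` for all `n`. This happens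
because the function `R_n(t)` vanishes at `t = 1, 0, −1, …, −n+2` so that `r_n = Σ_{t=−n+1}^{∞} R_n(t)`, and in
view of the following result. **Lemma 1.**" (The printed symmetry "`R_n(t) = R_n(2n−1−t)`" is, for the printed
`R_n`, the reflection `t ↦ 1 − 2n − t` about the centre `½ − n` of the poles `½, −½, …, ½ − 2n`; that is what
is used below.)

## What is proved (0 sorry, no definitions, no new named facts; net debt −2)

We follow the printed argument literally, with the tree's partial-fraction tools for the Ball–Rivoal /
Cresson–Fischler–Rivoal series (`BallRivoal.pfEval`, `CressonFischlerRivoal2008.exists_partialFractions`,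
`BallRivoal.pf_unique`, `BallRivoal.pfEval_reflect`, `BallRivoal.poch_reflect`):

* `RFour_shift_eq` — in the variable `q = t − 3/2` (poles at `q = −1, …, −(2n+1)`), `R_n` is the rational
  function `K_n (q + 3/2 − n)_{4n} / (q+1)_{2n+1}⁴`, `K_n = 2^{8n}n!⁴(2n)!²/(4n)!`, over `ℚ`;
* `closedForm_reflect` — its well-poised symmetry `q ↦ −q − 2n − 2` (i.e. `t ↦ 1 − 2n − t`);
* `exists_symmetric_pf` — partial fractions `R_n = Σ_{p≤2n} Σ_{o<4} c_{o,p}(q+p+1)^{−o−1}` with RATIONAL data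
  satisfying `c_{o,2n−p} = (−1)^{o+1}c_{o,p}` (uniqueness of partial fractions, as in the tree's
  `BallRivoal.pf_R_symm`);
* `R_cast_eq_pfEval` — these data are coefficient data for `Lemma1.R` (poles `0, −1, …, −2n`, orders `≤ 4`)
  with the symmetry `Lemma1.CoeffSymm` (`coeffSymm_of_pf`);
* `RFour_int_eq_zero` (`R_n(t) = 0` for the integers `1−n ≤ t ≤ 0`), `RFour_succ_nonneg` (`R_n(t) ≥ 0` at the
  integers `t ≥ 1`);
* `rFour_eq_of_pf` — for ANY rational data with the symmetry reproducing `R_n`: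
  `r_n = (Σ_p c_{3,p})/6 · π⁴ + (Σ_p c_{1,p})/2 · π²`: by `Lemma1.lemma1` (even case `2n`: no constant term,
  no odd zeta value) the partial sums of `Σ_{t ≥ 1−n} R_n(t)` tend to `a₂·3ζ(2) + a₄·15ζ(4)`; the first `n`
  terms vanish, the remaining terms are the nonnegative `R_n(u+1)`, so this is `r_n` (`tsum` of a nonnegative
  series with converging partial sums), and `ζ(2) = π²/6`, `ζ(4) = π⁴/90` (Mathlib);
* **`rFour_mem_span_holds : rFour_mem_span`** (from `exists_symmetric_pf`) and **`rFour_one_holds : rFour_one`**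
  (from the explicit partial fractions of `R_1(q + 3/2) = (128/3)(q+½)(q+3/2)(q+5/2)(q+7/2)/((q+1)(q+2)(q+3))⁴`:
  order-4 coefficients `−5/2, 24, −5/2`, order-2 coefficients `−311/12, −32/3, −311/12`, checked by `ring`).

Not done here: eq. (8) (`rFour_eq_hypergeometric`, the case `a = b = c = 2n+1` of Theorem 4 of the source).

HONEST FRAMING (cell zeta5-irr): a structural statement about a printed family of `π²`/`π⁴` forms; nothing
about `ζ(5)`, no irrationality content; no rung of any ladder moves.
-/

noncomputable section

open Finset Filter Topology Polynomial
open scoped Nat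

namespace Literature.NumberTheory.Irrationality.KrattenthalerZudilin2019

open Literature.NumberTheory.Transcendental (zetaValue)
open Literature.NumberTheory.Transcendental.BallRivoal (pfEval poch pochPoly eval_pochPoly degree_pochPoly_lt
  poch_reflect pf_unique pfEval_reflect pfEval_sub')
open Literature.NumberTheory.Irrationality.CressonFischlerRivoal2008 (exists_partialFractions)

namespace SectionFour

/-! ### `R_n` as a rational function over `ℚ` in the variable `q = t − 3/2` -/

/-- Off the poles: `q + p + 1 ≠ 0` for `p ≤ 2n` implies `(q+1)_{2n+1} ≠ 0`. [folklore] -/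
private theorem poch_succ_ne_zero (n : ℕ) (q : ℚ) (hq : ∀ p, p ≤ 2 * n → q + p + 1 ≠ 0) :
    poch (q + 1) (2 * n + 1) ≠ 0 := by
  unfold poch
  rw [prod_ne_zero_iff]
  intro p hp
  have := hq p (Nat.lt_succ_iff.mp (mem_range.mp hp))
  intro h; apply this; linarith

/-- **`R_n` in the shifted variable**: for rational `q` off the poles,
`R_n(q + 3/2) = K_n (q + 3/2 − n)_{4n} / (q+1)_{2n+1}⁴`, `K_n = 2^{8n}n!⁴(2n)!²/(4n)!`.
[cite: KrattenthalerZudilin2019, §4 (definition of R_n)] -/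
theorem RFour_shift_eq (n : ℕ) (q : ℚ) (hq : ∀ p, p ≤ 2 * n → q + p + 1 ≠ 0) :
    RFour n ((q : ℝ) + 3 / 2) =
      (((2 : ℚ) ^ (8 * n) * (n ! : ℚ) ^ 4 * ((2 * n)! : ℚ) ^ 2 / ((4 * n)! : ℚ) *
          poch (q + (3 / 2 - n)) (4 * n) / poch (q + 1) (2 * n + 1) ^ 4 : ℚ) : ℝ) := by
  have hpoch := poch_succ_ne_zero n q hq
  have hpochR : (poch (q + 1) (2 * n + 1) : ℝ) ≠ 0 := by exact_mod_cast hpoch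
  have hfact : ((4 * n)! : ℝ) ≠ 0 := by positivity
  have e1 : ∏ j ∈ range (4 * n), ((q : ℝ) + 3 / 2 - n + j) = (poch (q + (3 / 2 - n)) (4 * n) : ℝ) := by
    unfold poch; push_cast
    exact prod_congr rfl fun j _ => by ring
  have e2 : ∏ j ∈ range (2 * n + 1), ((q : ℝ) + 3 / 2 - 1 / 2 + j) ^ 4 =
      (poch (q + 1) (2 * n + 1) : ℝ) ^ 4 := by
    unfold poch; push_cast
    rw [← prod_pow]
    exact prod_congr rfl fun j _ => by ring
  unfold RFour
  rw [e1, e2]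
  push_cast
  field_simp

/-- **Well-poised symmetry of the closed form**: `q ↦ −q − 2n − 2` (that is `t ↦ 1 − 2n − t`) leaves
`(q + 3/2 − n)_{4n}/(q+1)_{2n+1}⁴` invariant (`(−x−k+1)_k = (−1)^k (x)_k` twice, even exponents).
[cite: KrattenthalerZudilin2019, §4 ("the well-poised symmetry")] -/
theorem closedForm_reflect (n : ℕ) (q : ℚ) :
    poch (-q - (2 * n : ℕ) - 2 + (3 / 2 - n)) (4 * n) / poch (-q - (2 * n : ℕ) - 2 + 1) (2 * n + 1) ^ 4 =
      poch (q + (3 / 2 - n)) (4 * n) / poch (q + 1) (2 * n + 1) ^ 4 := by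
  have h1 : poch (-q - (2 * n : ℕ) - 2 + 1) (2 * n + 1) = (-1) ^ (2 * n + 1) * poch (q + 1) (2 * n + 1) := by
    rw [← poch_reflect (q + 1) (2 * n + 1)]
    congr 1; push_cast; ring
  have h2 : poch (-q - (2 * n : ℕ) - 2 + (3 / 2 - n)) (4 * n) = (-1) ^ (4 * n) * poch (q + (3 / 2 - n)) (4 * n) := by
    rw [← poch_reflect (q + (3 / 2 - n)) (4 * n)]
    congr 1; push_cast; ring
  have h3 : ((-1 : ℚ) ^ (2 * n + 1)) ^ 4 = 1 := by
    rw [← pow_mul, show (2 * n + 1) * 4 = 2 * (4 * n + 2) by ring, pow_mul]; norm_num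
  have h4 : ((-1 : ℚ) ^ (4 * n)) = 1 := by
    rw [show 4 * n = 2 * (2 * n) by ring, pow_mul]; norm_num
  rw [h1, h2, mul_pow, h3, h4, one_mul, one_mul]

/-- **Partial fractions with the well-poised symmetry**: there are rational data `c_{o,p}` (`o < 4`,
`p ≤ 2n`) with `c_{o,2n−p} = (−1)^{o+1} c_{o,p}` and `R_n(q + 3/2) = Σ_{p≤2n} Σ_{o<4} c_{o,p}/(q+p+1)^{o+1}`
for every rational `q` off the poles. [cite: KrattenthalerZudilin2019, §4 ("expanding it into the sum of partial fractions; the well-poised symmetry")] -/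
theorem exists_symmetric_pf (n : ℕ) :
    ∃ c : ℕ → ℕ → ℚ, (∀ o p, o < 4 → p ≤ 2 * n → c o (2 * n - p) = (-1) ^ (o + 1) * c o p) ∧
      ∀ q : ℚ, (∀ p, p ≤ 2 * n → q + p + 1 ≠ 0) → RFour n ((q : ℝ) + 3 / 2) = (pfEval (2 * n) 4 c q : ℝ) := by
  set K : ℚ := (2 : ℚ) ^ (8 * n) * (n ! : ℚ) ^ 4 * ((2 * n)! : ℚ) ^ 2 / ((4 * n)! : ℚ) with hK
  set Q : ℚ[X] := C K * pochPoly (3 / 2 - n) (4 * n) with hQ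
  have hK0 : K ≠ 0 := by rw [hK]; positivity
  have hdeg : Q.degree < ((4 * (2 * n + 1) : ℕ) : WithBot ℕ) := by
    rw [hQ, degree_C_mul hK0]
    refine (degree_pochPoly_lt (3 / 2 - n) (4 * n)).trans_le ?_
    exact_mod_cast (by omega : 4 * n + 1 ≤ 4 * (2 * n + 1))
  obtain ⟨c, hc⟩ := exists_partialFractions (2 * n) 4 (by norm_num) Q hdeg
  have hQev : ∀ q : ℚ, Q.eval q = K * poch (q + (3 / 2 - n)) (4 * n) := by
    intro q; rw [hQ, eval_mul, eval_C, eval_pochPoly]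
  -- the closed form `F(q) = Q(q)/(q+1)_{2n+1}^4` and its symmetry
  have hF : ∀ q : ℚ, (∀ p, p ≤ 2 * n → q + p + 1 ≠ 0) →
      pfEval (2 * n) 4 c q = K * (poch (q + (3 / 2 - n)) (4 * n) / poch (q + 1) (2 * n + 1) ^ 4) := by
    intro q hq
    rw [hc q hq, hQev, show 2 * n + 1 = 2 * n + 1 from rfl]
    ring
  refine ⟨c, fun o p ho hp => ?_, fun q hq => ?_⟩
  · -- symmetry of the data by uniqueness (pattern of `BallRivoal.pf_R_symm`)
    set e : ℕ → ℕ → ℚ := fun o p => (-1) ^ (o + 1) * c o (2 * n - p) - c o p with he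
    have hev : ∀ t : ℕ, 0 ≤ t → pfEval (2 * n) 4 e t = 0 := by
      intro t _
      have h1 : ∀ m, m ≤ 2 * n → (t : ℚ) + m + 1 ≠ 0 := fun m _ => by positivity
      have h2 : ∀ m, m ≤ 2 * n → (-(t : ℚ) - (2 * n : ℕ) - 2) + m + 1 ≠ 0 := by
        intro m hm h0
        have : (m : ℚ) ≤ (2 * n : ℕ) := by exact_mod_cast hm
        have ht0 : (0 : ℚ) ≤ t := by positivity
        linarith
      rw [he, pfEval_sub', pfEval_reflect, hF _ h2, hF _ h1]
      have := closedForm_reflect n t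
      rw [show -(t : ℚ) - (2 * n : ℕ) - 2 + (3 / 2 - n) = -(t : ℚ) - (2 * n : ℕ) - 2 + (3 / 2 - n) from rfl]
        at this
      rw [this, sub_self]
    have h0 := pf_unique (2 * n) 4 e 0 hev o p ho hp
    rw [he] at h0
    simp only at h0
    have hsq : ((-1 : ℚ) ^ (o + 1)) * ((-1 : ℚ) ^ (o + 1)) = 1 := by
      rw [← pow_add, ← two_mul, pow_mul]; norm_num
    have h1 : (-1 : ℚ) ^ (o + 1) * c o (2 * n - p) = c o p := by linarith
    calc c o (2 * n - p) = ((-1 : ℚ) ^ (o + 1) * (-1 : ℚ) ^ (o + 1)) * c o (2 * n - p) := by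
          rw [hsq, one_mul]
      _ = (-1 : ℚ) ^ (o + 1) * ((-1 : ℚ) ^ (o + 1) * c o (2 * n - p)) := by ring
      _ = (-1) ^ (o + 1) * c o p := by rw [h1]
  · rw [RFour_shift_eq n q hq, hF q hq, hK]
    push_cast
    ring

/-! ### From `pfEval` data to `Lemma1` coefficient data -/

/-- The tree's two partial-fraction evaluations agree: with `a_{i,k} = c_{i−1,k}`,
`Lemma1.R a K N (q + 1) = pfEval N K c q` (poles `q + p + 1 = (q+1) + p`). [folklore] -/
private theorem R_cast_eq_pfEval (N K : ℕ) (c : ℕ → ℕ → ℚ) (q : ℚ) :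
    Lemma1.R (fun i k => (c (i - 1) k : ℝ)) K N ((q : ℝ) + 1) = (pfEval N K c q : ℝ) := by
  unfold Lemma1.R pfEval
  push_cast
  rw [sum_comm]
  refine sum_congr rfl fun p _ => ?_
  rw [← Finset.Ico_add_one_right_eq_Icc, sum_Ico_eq_sum_range]
  simp only [Nat.add_sub_cancel, Nat.add_sub_cancel_left]
  refine sum_congr rfl fun o _ => ?_
  rw [add_comm 1 o]
  ring

/-- The symmetry of the data is `Lemma1.CoeffSymm` for `a_{i,k} = c_{i−1,k}`, `s = 4`, poles `0, …, −2n`.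
[cite: KrattenthalerZudilin2019, Lemma 1 (first assertion)] -/
theorem coeffSymm_of_pf (n : ℕ) (c : ℕ → ℕ → ℚ)
    (hsymm : ∀ o p, o < 4 → p ≤ 2 * n → c o (2 * n - p) = (-1) ^ (o + 1) * c o p) :
    Lemma1.CoeffSymm (fun i k => (c (i - 1) k : ℝ)) 4 (2 * n) := by
  intro i hi k hk
  have hi' := mem_Icc.mp hi
  have h := hsymm (i - 1) k (by omega) hk
  have hi1 : i - 1 + 1 = i := by omega
  rw [hi1] at h
  simp only
  exact_mod_cast h

/-! ### Zeros and sign of `R_n` at the integers -/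

/-- `R_n(t) = 0` at the integers `t = 1 − n, 2 − n, …, 0` (a factor `t − n + j` vanishes for some `n ≤ j < 2n`):
written `R_n(t' + 1 − n) = 0` for `t' < n`. [cite: KrattenthalerZudilin2019, §4 ("the function R_n(t) vanishes at t = 1, 0, −1, …")] -/
theorem RFour_int_eq_zero (n t' : ℕ) (ht : t' < n) : RFour n ((t' : ℝ) + 1 - n) = 0 := by
  obtain ⟨d, rfl⟩ : ∃ d, n = t' + 1 + d := ⟨n - t' - 1, by omega⟩
  unfold RFour
  have hz : ∏ j ∈ range (4 * (t' + 1 + d)), ((t' : ℝ) + 1 - (t' + 1 + d : ℕ) - (t' + 1 + d : ℕ) + j) = 0 := by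
    refine prod_eq_zero (i := t' + 1 + 2 * d) (mem_range.mpr (by omega)) ?_
    push_cast; ring
  rw [hz, mul_zero, zero_div]

/-- `R_n(u+1) ≥ 0` for every natural `u` (for `u ≥ n` all factors are positive; for `u < n` a factor vanishes).
[cite: KrattenthalerZudilin2019, §4 (definition of R_n)] -/
theorem RFour_succ_nonneg (n u : ℕ) : 0 ≤ RFour n ((u : ℝ) + 1) := by
  rcases Nat.lt_or_ge u n with hlt | hge
  · obtain ⟨d, rfl⟩ : ∃ d, n = u + 1 + d := ⟨n - u - 1, by omega⟩
    unfold RFour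
    have hz : ∏ j ∈ range (4 * (u + 1 + d)), ((u : ℝ) + 1 - (u + 1 + d : ℕ) + j) = 0 := by
      refine prod_eq_zero (i := d) (mem_range.mpr (by omega)) ?_
      push_cast; ring
    rw [hz, mul_zero, zero_div]
  · unfold RFour
    refine div_nonneg (mul_nonneg (by positivity) (prod_nonneg fun j _ => ?_)) (by positivity)
    have : (n : ℝ) ≤ u := by exact_mod_cast hge
    have hj : (0 : ℝ) ≤ j := by positivity
    linarith

/-! ### Lemma 1, even case `2n`: the sample points and the constant term -/

/-- `firstPoint (2n) = −n + ½`. [cite: KrattenthalerZudilin2019, Lemma 1 (m = ⌊(n−1)/2⌋)] -/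
theorem firstPoint_two_mul (n : ℕ) : Lemma1.firstPoint (2 * n) = -(n : ℝ) + 1 / 2 := by
  unfold Lemma1.firstPoint
  rw [if_pos (even_two_mul n)]
  push_cast; ring

/-- `a_0 = 0` for the even parameter `2n`. [cite: KrattenthalerZudilin2019, Lemma 1 (a_0 = 0 for n even)] -/
theorem aZero_two_mul (a : ℕ → ℕ → ℝ) (s n : ℕ) : Lemma1.aZero a s (2 * n) = 0 := by
  unfold Lemma1.aZero
  rw [if_pos (even_two_mul n)]

/-- `{i ∈ [1,4] : i even} = {2, 4}`. [folklore] -/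
private theorem filter_even_Icc_one_four : (Icc 1 4).filter Even = ({2, 4} : Finset ℕ) := by
  ext i
  simp only [mem_filter, mem_Icc, mem_insert, mem_singleton]
  constructor
  · rintro ⟨⟨h1, h4⟩, he⟩
    interval_cases i
    · exact absurd he (by decide)
    · exact Or.inl rfl
    · exact absurd he (by decide)
    · exact Or.inr rfl
  · rintro (rfl | rfl)
    · exact ⟨⟨by norm_num, by norm_num⟩, by decide⟩
    · exact ⟨⟨by norm_num, by norm_num⟩, by decide⟩

/-! ### From symmetric partial-fraction data to the value of `r_n` -/

/-- **The summation** ("residue sum theorem" + Lemma 1): if rational data `c_{o,p}` with the well-poised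
symmetry reproduce `R_n` off the poles, then `r_n = (Σ_p c_{3,p})/6 · π⁴ + (Σ_p c_{1,p})/2 · π²` — Lemma 1 in the
even case `2n` over the sample points `t = 1−n, 2−n, …` (the first `n` of which are zeros of `R_n`), the
nonnegativity of the remaining terms `R_n(u+1)` (so the converging partial sums give the `tsum`), and
`(2²−1)ζ(2) = π²/2`, `(2⁴−1)ζ(4) = π⁴/6`.
[cite: KrattenthalerZudilin2019, §4 (paragraph before Lemma 1) and Lemma 1] -/
theorem rFour_eq_of_pf (n : ℕ) (c : ℕ → ℕ → ℚ)
    (hsymm : ∀ o p, o < 4 → p ≤ 2 * n → c o (2 * n - p) = (-1) ^ (o + 1) * c o p)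
    (hpf : ∀ q : ℚ, (∀ p, p ≤ 2 * n → q + p + 1 ≠ 0) → RFour n ((q : ℝ) + 3 / 2) = (pfEval (2 * n) 4 c q : ℝ)) :
    rFour n = ((∑ k ∈ range (2 * n + 1), c 3 k : ℚ) : ℝ) / 6 * Real.pi ^ 4 +
      ((∑ k ∈ range (2 * n + 1), c 1 k : ℚ) : ℝ) / 2 * Real.pi ^ 2 := by
  set a : ℕ → ℕ → ℝ := fun i k => (c (i - 1) k : ℝ) with ha
  have hcs : Lemma1.CoeffSymm a 4 (2 * n) := coeffSymm_of_pf n c hsymm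
  -- the sample points of Lemma 1 are the integers `t = t' + 1 − n`
  have hsample : ∀ t' : ℕ,
      Lemma1.R a 4 (2 * n) (Lemma1.firstPoint (2 * n) + t') = RFour n ((t' : ℝ) + 1 - n) := by
    intro t'
    set q : ℚ := (t' : ℚ) - n - 1 / 2 with hq
    have hqoff : ∀ p, p ≤ 2 * n → q + p + 1 ≠ 0 := by
      intro p _ h0
      rw [hq] at h0
      have h3 : (2 * (t' + p) + 1 : ℕ) = 2 * n := by
        exact_mod_cast (show ((2 * (t' + p) + 1 : ℕ) : ℚ) = ((2 * n : ℕ) : ℚ) by push_cast; linarith)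
      omega
    have e1 : Lemma1.firstPoint (2 * n) + (t' : ℝ) = (q : ℝ) + 1 := by
      rw [firstPoint_two_mul, hq]; push_cast; ring
    have e2 : (t' : ℝ) + 1 - n = (q : ℝ) + 3 / 2 := by rw [hq]; push_cast; ring
    rw [e1, e2, ha, R_cast_eq_pfEval, hpf q hqoff]
  -- Lemma 1 (even case): the partial sums over the sample points converge
  have hL := Lemma1.lemma1 hcs
  rw [aZero_two_mul, add_zero] at hL
  set S : ℝ := ∑ i ∈ (Icc 1 4).filter Even, Lemma1.aSum a (2 * n) i * ((2 ^ i - 1) * zetaValue i)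
    with hS
  -- dropping the `n` vanishing terms: shifted partial sums are the partial sums of `r_n`
  have hshift : ∀ M : ℕ, ∑ t' ∈ range (n + M), Lemma1.R a 4 (2 * n) (Lemma1.firstPoint (2 * n) + t') =
      ∑ u ∈ range M, RFour n ((u : ℝ) + 1) := by
    intro M
    rw [sum_range_add]
    have h0 : ∑ t' ∈ range n, Lemma1.R a 4 (2 * n) (Lemma1.firstPoint (2 * n) + t') = 0 := by
      refine sum_eq_zero fun t' ht' => ?_
      rw [hsample, RFour_int_eq_zero n t' (mem_range.mp ht')]
    rw [h0, zero_add]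
    refine sum_congr rfl fun u _ => ?_
    rw [hsample]
    congr 1
    push_cast; ring
  have hT : Tendsto (fun M : ℕ => ∑ u ∈ range M, RFour n ((u : ℝ) + 1)) atTop (𝓝 S) := by
    have h := hL.comp (tendsto_add_atTop_nat n)
    refine h.congr fun M => ?_
    simp only [Function.comp]
    rw [add_comm M n]
    exact hshift M
  have hsum : HasSum (fun u : ℕ => RFour n ((u : ℝ) + 1)) S :=
    (hasSum_iff_tendsto_nat_of_nonneg (RFour_succ_nonneg n) S).mpr hT
  have hr : rFour n = S := by rw [rFour]; exact hsum.tsum_eq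
  -- evaluate: `S = a₂·3ζ(2) + a₄·15ζ(4)`, `ζ(2) = π²/6`, `ζ(4) = π⁴/90`
  have h2 : zetaValue 2 = Real.pi ^ 2 / 6 := by rw [zetaValue, hasSum_zeta_two.tsum_eq]
  have h4 : zetaValue 4 = Real.pi ^ 4 / 90 := by rw [zetaValue, hasSum_zeta_four.tsum_eq]
  have hA2 : Lemma1.aSum a (2 * n) 2 = ((∑ k ∈ range (2 * n + 1), c 1 k : ℚ) : ℝ) := by
    rw [Lemma1.aSum, ha]; push_cast; rfl
  have hA4 : Lemma1.aSum a (2 * n) 4 = ((∑ k ∈ range (2 * n + 1), c 3 k : ℚ) : ℝ) := by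
    rw [Lemma1.aSum, ha]; push_cast; rfl
  rw [hr, hS, filter_even_Icc_one_four, sum_pair (by norm_num), hA2, hA4, h2, h4]
  ring

end SectionFour

/-- **Krattenthaler–Zudilin 2019, §4 — PROVED** (discharges the named fact `rFour_mem_span`): for every `n`,
`r_n = Σ_{t≥1} R_n(t) = a_nπ⁴ − b_nπ²` with rational `a_n, b_n` — partial fractions with the well-poised
symmetry, `r_n = Σ_{t ≥ 1−n} R_n(t)` (the added terms vanish), and Lemma 1 in the even case (no odd zeta value,
no constant term), `ζ(2) = π²/6`, `ζ(4) = π⁴/90`.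
[cite: KrattenthalerZudilin2019, §4 (paragraph before Lemma 1) and Lemma 1] -/
theorem rFour_mem_span_holds : rFour_mem_span := by
  intro n
  obtain ⟨c, hsymm, hpf⟩ := SectionFour.exists_symmetric_pf n
  refine ⟨(∑ k ∈ range (2 * n + 1), c 3 k) / 6, -(∑ k ∈ range (2 * n + 1), c 1 k) / 2, ?_⟩
  rw [SectionFour.rFour_eq_of_pf n c hsymm hpf]
  push_cast
  ring

/-- **`r_1 = 19π⁴/6 − 125π²/4` — PROVED** (discharges the named fact `rFour_one`): the explicit partial fractions
of `R_1(q + 3/2) = (128/3)(q+½)(q+3/2)(q+5/2)(q+7/2)/((q+1)(q+2)(q+3))⁴` have order-4 coefficients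
`−5/2, 24, −5/2` (sum `19`) and order-2 coefficients `−311/12, −32/3, −311/12` (sum `−125/2`).
[cite: KrattenthalerZudilin2019, §4 (display "r_0 = π⁴/6, r_1 = 19π⁴/6 − 125π²/4")] -/
theorem rFour_one_holds : rFour_one := by
  set c : ℕ → ℕ → ℚ := fun o p =>
    if o = 0 then (if p = 0 then 125 / 4 else if p = 1 then 0 else -125 / 4)
    else if o = 1 then (if p = 1 then -32 / 3 else -311 / 12)
    else if o = 2 then (if p = 0 then 37 / 3 else if p = 1 then 0 else -37 / 3)
    else (if p = 1 then 24 else -5 / 2) with hc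
  have hsymm : ∀ o p, o < 4 → p ≤ 2 * 1 → c o (2 * 1 - p) = (-1) ^ (o + 1) * c o p := by
    intro o p ho hp
    interval_cases o <;> interval_cases p <;> norm_num [hc]
  have hpf : ∀ q : ℚ, (∀ p : ℕ, p ≤ 2 * 1 → q + p + 1 ≠ 0) →
      RFour 1 ((q : ℝ) + 3 / 2) = (pfEval (2 * 1) 4 c q : ℝ) := by
    intro q hq
    have h1 : q + 1 ≠ 0 := by have := hq 0 (by norm_num); norm_num at this; exact this
    have h2 : q + 2 ≠ 0 := by
      have := hq 1 (by norm_num); norm_num at this; intro h; apply this; linarith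
    have h3 : q + 3 ≠ 0 := by
      have := hq 2 (by norm_num); norm_num at this; intro h; apply this; linarith
    have hexp : pfEval (2 * 1) 4 c q =
        125 / 4 / (q + 1) + (-311 / 12) / (q + 1) ^ 2 + 37 / 3 / (q + 1) ^ 3 + (-5 / 2) / (q + 1) ^ 4 +
        (0 / (q + 2) + (-32 / 3) / (q + 2) ^ 2 + 0 / (q + 2) ^ 3 + 24 / (q + 2) ^ 4) +
        ((-125 / 4) / (q + 3) + (-311 / 12) / (q + 3) ^ 2 + (-37 / 3) / (q + 3) ^ 3 +
          (-5 / 2) / (q + 3) ^ 4) := by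
      unfold pfEval
      simp only [sum_range_succ, sum_range_zero, hc]
      norm_num
      ring
    have hclosed : (2 : ℚ) ^ (8 * 1) * ((1 : ℕ)! : ℚ) ^ 4 * ((2 * 1)! : ℚ) ^ 2 / ((4 * 1)! : ℚ) *
          poch (q + (3 / 2 - (1 : ℕ))) (4 * 1) / poch (q + 1) (2 * 1 + 1) ^ 4 =
        128 / 3 * ((q + 1 / 2) * (q + 3 / 2) * (q + 5 / 2) * (q + 7 / 2)) /
          ((q + 1) * (q + 2) * (q + 3)) ^ 4 := by
      unfold poch
      simp only [prod_range_succ, prod_range_zero, Nat.factorial]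
      push_cast
      ring
    rw [SectionFour.RFour_shift_eq 1 q hq]
    congr 1
    rw [hexp, hclosed]
    field_simp
    ring
  have h := SectionFour.rFour_eq_of_pf 1 c hsymm hpf
  have hs1 : ∑ k ∈ range (2 * 1 + 1), c 1 k = -125 / 2 := by
    simp only [sum_range_succ, sum_range_zero, hc]; norm_num
  have hs3 : ∑ k ∈ range (2 * 1 + 1), c 3 k = 19 := by
    simp only [sum_range_succ, sum_range_zero, hc]; norm_num
  rw [hs1, hs3] at h
  rw [rFour_one, h]
  push_cast
  ring

end Literature.NumberTheory.Irrationality.KrattenthalerZudilin2019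

end
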